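import Mathlib
import Literature.AlgebraicGeometry.Resolution.CobordantBlowupGlobal
import Literature.AlgebraicGeometry.Resolution.CobordantBlowup
import Literature.AlgebraicGeometry.Resolution.IdealSheafLemmas
import Summits.ResolutionOfSingularities.ResolutionOfSingularities.Theorems.WeightedInvariantDatumToEmbeddedCentreHomogeneous
import HarnessLib

/-!
# Lemma 2.3.8 on the charts `D(uᵢ t^{wᵢ})` of the global cobordant blow-up

Topic: `Summits/ResolutionOfSingularities/ResolutionOfSingularities/Theorems`. Chart computations
for stub `stub_qs_exceptional` of the line `Sketch` of the crux
`Theses.WeightedInvariant.DatumToEmbedded` (statement `stmt-ResolutionOfSingularities-0572`) of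
the summit `Summit.ResolutionOfSingularities.ResolutionOfSingularities`; the stub itself is
`Theorems/WeightedInvariantDatumToEmbeddedExceptional.lean`.

Setting (J. Włodarczyk, arXiv:2203.03090, Def. 2.3.5, Lemma 2.3.8, §2.3.9, App. Def. 5.1.1; tree:
`Literature/AlgebraicGeometry/Resolution/CobordantBlowupGlobal.lean`): for a Rees filtration `R'`
on `Y` the full cobordant blow-up `B = Spec_Y ⊕ₙ 𝒥ₙ tⁿ` is glued from the charts
`Spec ⊕ₙ 𝒥ₙ(U) tⁿ` over the affine opens `U`, `B₊ ⊆ B` is the union of the complements of the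
vertices `V(⊕_{n>0} 𝒥ₙ(U) tⁿ)`, and the exceptional ideal sheaf is `(t⁻¹)`. Over an affine open
`U` on which the filtration is the weighted filtration `𝒥ₙ(U) = (u^α : Σ αᵢ wᵢ ≥ n)` of sections
`u₁, …, uₘ` with positive weights `w`, the sections ring `⊕ₙ 𝒥ₙ(U) tⁿ ⊆ Γ(Y, U)[t, t⁻¹]` contains
`t⁻¹` and the `vᵢ = uᵢ t^{wᵢ}`, and Lemma 2.3.8 ("`𝒥 · 𝒪_{B₊} = t⁻¹ · 𝒪_{B₊}`") reads, in
integral form on the chart `D(vᵢ)`: `𝒥ₙ · 𝒪 = ((t⁻¹)ⁿ)` whenever `wᵢ ∣ n`.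

* ring level (`IdealFiltration.extendedRees` of a filtration with monomial pieces): `algebraMap_u`
  (`uᵢ = (t⁻¹)^{wᵢ} vᵢ`, §2.3.9), `map_span_weightedMonomials` (**Lemma 2.3.8**: after inverting
  `vᵢ₀`, `𝒥ₙ` extends to `((t⁻¹)ⁿ)` for `wᵢ₀ ∣ n`), `v_mem_irrelevant`, `irrelevant_le_span_range`
  (the irrelevant ideal lies in `(v₁, …, vₘ)`: the `D(vᵢ)` cover the vertex complement);
* `comap_pow_of_isOpenImmersion` — powers of ideal sheaves commute with pull-back along open
  immersions;
* chart level, for an ARBITRARY scheme `B` with `π : B ⟶ Y`, `τ : B ⟶ 𝔸¹ = Spec ℤ[x]`, an open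
  `O ⊆ B` and a chart `φ : Spec ⊕ₙ 𝒥ₙ(U) tⁿ ⟶ B` over `U` (hypotheses `hφπ`, `hφA`, `hO`, as
  `R'.openCover.f U` is by `R'.ι_π`, `R'.ι_toA1`, `R'.image_plusChart_le_plus` — keeping the glued
  scheme out of the statements, as in `…DatumToEmbedded.StrictTransform`), and any localisations
  `L i` of the sections ring at the `vᵢ`: the charts `ψᵢ : Spec (L i) ⟶ O` (`exists_fac`,
  `isOpenImmersion_of_fac`) cover the vertex complement (`specMap_mem_plusChart`,
  `exists_specMap_eq`), and **on `ψᵢ` both `(O → Y)^* K` (for `K(U) = 𝒥ₙ(U)`, `wᵢ ∣ n`) and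
  `((τ^*(x))|_O)ⁿ` are the ideal sheaf of `((t⁻¹)ⁿ)`** (`comap_comap_eq_ofIdealTop`,
  `comap_pow_eq_ofIdealTop`, `comap_comap_eq_comap_pow`).

All proofs are glue on Mathlib and the tree; no definitions, no named facts.
-/

noncomputable section

open scoped LaurentPolynomial
open LaurentPolynomial CategoryTheory CategoryTheory.Limits AlgebraicGeometry TopologicalSpace
open Literature.AlgebraicGeometry.Resolution
open Summit.ResolutionOfSingularities.ResolutionOfSingularities.Theorems

set_option linter.dupNamespace false -- mandated namespace `…Theorems.DatumToEmbedded.<Topic>`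

namespace Summit.ResolutionOfSingularities.ResolutionOfSingularities.Theorems.DatumToEmbedded.Exceptional

universe u

/-! ## Ring level: `𝒥ₙ · 𝒪 = (t⁻¹)ⁿ` on the charts `D(uᵢ t^{wᵢ})` of `Spec ⊕ₙ 𝒥ₙ tⁿ` -/

section Ring

variable {A : Type u} [CommRing A] (F : IdealFiltration A) {m : ℕ} (u : Fin m → A) (w : Fin m → ℕ)
  (hF : ∀ n, F.ideal n = Ideal.span (weightedMonomials u w n))
  (t : F.extendedRees) (ht : (t : A[T;T⁻¹]) = T (-1))
  (v : Fin m → F.extendedRees)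
  (hv : ∀ i, ((v i : F.extendedRees) : A[T;T⁻¹]) = C (u i) * T (w i : ℤ))

include ht in
/-- `(t⁻¹)ⁿ = T⁻ⁿ` in the Laurent polynomial ring. [folklore] -/
theorem coe_t_pow (n : ℕ) : ((t ^ n : F.extendedRees) : A[T;T⁻¹]) = T (-(n : ℤ)) := by
  rw [SubmonoidClass.coe_pow, ht, T_pow]
  congr 1
  ring

include ht hv in
/-- The local equations `uᵢ = (t⁻¹)^{wᵢ} · (uᵢ t^{wᵢ})` in `⊕ₙ 𝒥ₙ tⁿ` (Włodarczyk 2022, §2.3.9: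
`xᵢ = s^{wᵢ} xᵢ'`). [cite: Wlodarczyk2022, §2.3.9] -/
theorem algebraMap_u (i : Fin m) : algebraMap A F.extendedRees (u i) = t ^ (w i) * v i := by
  apply Subtype.ext
  rw [Subalgebra.coe_algebraMap, ← C_eq_algebraMap, MulMemClass.coe_mul, coe_t_pow F t ht, hv,
    T_mul, mul_T_assoc, add_neg_cancel, T_zero, mul_one]

include hv in
/-- In `A[t, t⁻¹]`: `∏ (uᵢ t^{wᵢ})^{αᵢ} = u^α t^{Σ αᵢ wᵢ}`. [folklore] -/
theorem coe_prod_v_pow (α : Fin m →₀ ℕ) :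
    ((α.prod fun i e => v i ^ e : F.extendedRees) : A[T;T⁻¹]) =
      C (α.prod fun i e => u i ^ e) * T ((Finsupp.weight w α : ℕ) : ℤ) := by
  rw [← coe_prod_u'_pow u w α]
  change F.extendedRees.val (α.prod fun i e => v i ^ e) =
    (cobordantAlgebra u w).val (α.prod fun i e => cobordantAlgebra.u' u w i ^ e)
  rw [map_finsuppProd, map_finsuppProd]
  refine Finsupp.prod_congr fun i _ => ?_
  rw [map_pow, map_pow, Subalgebra.val_apply, Subalgebra.val_apply, hv, cobordantAlgebra.coe_u']

include ht hv in
/-- `u^α = (t⁻¹)^{Σ αᵢ wᵢ} · ∏ (uᵢ t^{wᵢ})^{αᵢ}` in `⊕ₙ 𝒥ₙ tⁿ`. [folklore] -/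
theorem algebraMap_prod_pow (α : Fin m →₀ ℕ) :
    algebraMap A F.extendedRees (α.prod fun i e => u i ^ e) =
      t ^ (Finsupp.weight w α) * α.prod fun i e => v i ^ e := by
  apply Subtype.ext
  rw [Subalgebra.coe_algebraMap, ← C_eq_algebraMap, MulMemClass.coe_mul, coe_t_pow F t ht,
    coe_prod_v_pow F u w v hv, T_mul, mul_T_assoc, add_neg_cancel, T_zero, mul_one]

include ht hv in
/-- **Lemma 2.3.8 in integral form on a chart of `B₊`** (Włodarczyk 2022: "`𝒥 · 𝒪_{B₊} =
t⁻¹ · 𝒪_{B₊}`"): over any ring in which `uᵢ₀ t^{wᵢ₀}` becomes a unit, for `wᵢ₀ ∣ n` the piece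
`𝒥ₙ = (u^α : Σ αᵢ wᵢ ≥ n)` generates the principal ideal `((t⁻¹)ⁿ)`: a generator `u^α` is
`(t⁻¹)^{Σ αw} ∏ (uᵢ t^{wᵢ})^{αᵢ}`, and `(t⁻¹)^{wᵢ₀} = uᵢ₀ · (uᵢ₀ t^{wᵢ₀})⁻¹`.
[cite: Wlodarczyk2022, Lemma 2.3.8] -/
theorem map_span_weightedMonomials {S : Type*} [CommRing S] (φ : F.extendedRees →+* S) {n : ℕ}
    {i₀ : Fin m} (hn : w i₀ ∣ n) (hi₀ : IsUnit (φ (v i₀))) :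
    (Ideal.span (weightedMonomials u w n)).map (φ.comp (algebraMap A F.extendedRees)) =
      Ideal.span {φ t ^ n} := by
  apply le_antisymm
  · rw [Ideal.map_span, Ideal.span_le]
    rintro _ ⟨_, ⟨α, hα, rfl⟩, rfl⟩
    rw [SetLike.mem_coe, RingHom.comp_apply, algebraMap_prod_pow F u w t ht v hv α, map_mul,
      map_pow]
    obtain ⟨k, hk⟩ := Nat.exists_eq_add_of_le hα
    rw [hk, pow_add, mul_assoc]
    exact Ideal.mul_mem_right _ _ (Ideal.mem_span_singleton_self _)
  · rw [Ideal.span_singleton_le_iff_mem]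
    obtain ⟨c, rfl⟩ := hn
    obtain ⟨x, hx⟩ := hi₀
    have e : φ t ^ (w i₀ * c) = φ (algebraMap A F.extendedRees (u i₀ ^ c)) * ↑(x⁻¹ ^ c) := by
      rw [map_pow, algebraMap_u F u w t ht v hv i₀, map_pow, map_mul, map_pow, ← hx, mul_pow,
        pow_mul, mul_assoc, ← Units.val_pow_eq_pow_val, ← Units.val_mul, ← mul_pow,
        mul_inv_cancel, one_pow, Units.val_one, mul_one]
    have hmem : φ.comp (algebraMap A F.extendedRees) (u i₀ ^ c) ∈
        (Ideal.span (weightedMonomials u w (w i₀ * c))).map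
          (φ.comp (algebraMap A F.extendedRees)) :=
      Ideal.mem_map_of_mem _ (Ideal.subset_span ⟨Finsupp.single i₀ c,
        by rw [Finsupp.weight_single, smul_eq_mul, mul_comm],
        by rw [Finsupp.prod_single_index (h := fun i e => u i ^ e) (pow_zero _)]⟩)
    rw [RingHom.comp_apply] at hmem
    rw [e]
    exact Ideal.mul_mem_right _ _ hmem

/-- **Sub-goal `stub_qs_exceptional_ring`** registered on the crux item for this helper file of
stub `stub_qs_exceptional`: Lemma 2.3.8 in the extended Rees algebra (`map_span_weightedMonomials`
at universe `0`). [cite: Wlodarczyk2022, Lemma 2.3.8] -/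
theorem stub_qs_exceptional_ring :
    ∀ {A : Type} [CommRing A] (F : IdealFiltration A) {m : ℕ} (u : Fin m → A) (w : Fin m → ℕ)
      (t : F.extendedRees), (t : LaurentPolynomial A) = LaurentPolynomial.T (-1) →
      ∀ (v : Fin m → F.extendedRees),
      (∀ i, (v i : LaurentPolynomial A) =
        LaurentPolynomial.C (u i) * LaurentPolynomial.T (w i : ℤ)) →
      ∀ {S : Type} [CommRing S] (φ : F.extendedRees →+* S) {n : ℕ} {i₀ : Fin m}, w i₀ ∣ n →
      IsUnit (φ (v i₀)) →
      (Ideal.span (weightedMonomials u w n)).map (φ.comp (algebraMap A F.extendedRees)) =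
        Ideal.span {φ t ^ n} :=
  by
  intro A _ F m u w t ht v hv S _ φ n i₀ hn hi₀
  exact map_span_weightedMonomials F u w t ht v hv φ hn hi₀

include hF hv in
/-- For `wᵢ > 0` the element `uᵢ t^{wᵢ}` lies in the irrelevant ideal `⊕_{n>0} 𝒥ₙ tⁿ`.
[folklore] -/
theorem v_mem_irrelevant {i : Fin m} (hw : 0 < w i) : v i ∈ F.irrelevant :=
  Ideal.subset_span ⟨w i, u i, hw, by rw [hF (w i)]; exact mem_weightedFiltration_ideal u w i,
    hv i⟩

include hF ht hv in
/-- **The irrelevant ideal lies in `(u₁ t^{w₁}, …, uₘ t^{wₘ})`**: a generator `a tⁿ` (`n ≥ 1`,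
`a ∈ 𝒥ₙ = (u^α : Σ αᵢwᵢ ≥ n)`) is a combination of the `(t⁻¹)^{Σαw − n} ∏ (uᵢ t^{wᵢ})^{αᵢ}` with
`α ≠ 0` — so the complement of the vertex is covered by the charts `D(uᵢ t^{wᵢ})` (Włodarczyk
2022, Def. 2.3.5: `B₊ = B ∖ V(t^{w₁}x₁, …, t^{w_k}x_k)`). [cite: Wlodarczyk2022, Def. 2.3.5] -/
theorem irrelevant_le_span_range : F.irrelevant ≤ Ideal.span (Set.range v) := by
  rw [IdealFiltration.irrelevant, Ideal.span_le]
  rintro p ⟨n, a, hn, ha, hp⟩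
  rw [hF n] at ha
  suffices key : ∀ a ∈ Ideal.span (weightedMonomials u w n), ∀ q : F.extendedRees,
      (q : A[T;T⁻¹]) = C a * T (n : ℤ) → q ∈ Ideal.span (Set.range v) from key a ha p hp
  intro a ha
  induction ha using Submodule.span_induction with
  | mem a hmem =>
    obtain ⟨α, hα, rfl⟩ := hmem
    intro q hq
    obtain ⟨k, hk⟩ := Nat.exists_eq_add_of_le hα
    have hq' : q = t ^ k * α.prod fun i e => v i ^ e := Subtype.ext (by
      rw [hq, MulMemClass.coe_mul, coe_t_pow F t ht, coe_prod_v_pow F u w v hv, hk, T_mul,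
        mul_T_assoc]
      congr 2
      push_cast
      ring)
    have hα0 : α ≠ 0 := by
      rintro rfl
      rw [map_zero] at hk
      omega
    obtain ⟨i, hi⟩ := Finsupp.support_nonempty_iff.mpr hα0
    rw [hq', ← Finsupp.mul_prod_erase α i _ hi]
    have hvi : v i ^ α i ∈ Ideal.span (Set.range v) :=
      Ideal.pow_mem_of_mem _ (Ideal.subset_span (Set.mem_range_self i)) _
        (Nat.pos_of_ne_zero (Finsupp.mem_support_iff.mp hi))
    exact Ideal.mul_mem_left _ _ (Ideal.mul_mem_right _ _ hvi)
  | zero =>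
    intro q hq
    rw [map_zero, zero_mul] at hq
    rw [show q = 0 from Subtype.ext hq]
    exact Ideal.zero_mem _
  | add a b ha hb iha ihb =>
    intro q hq
    have ha' : a ∈ F.ideal n := by rw [hF n]; exact ha
    have hb' : b ∈ F.ideal n := by rw [hF n]; exact hb
    have e : q = ⟨C a * T (n : ℤ), F.C_mul_T_mem_extendedRees_iff.mpr ha'⟩ +
        ⟨C b * T (n : ℤ), F.C_mul_T_mem_extendedRees_iff.mpr hb'⟩ :=
      Subtype.ext (by rw [hq, AddMemClass.coe_add, map_add, add_mul])
    rw [e]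
    exact Ideal.add_mem _ (iha _ rfl) (ihb _ rfl)
  | smul c a ha iha =>
    intro q hq
    have ha' : a ∈ F.ideal n := by rw [hF n]; exact ha
    have e : q = algebraMap A F.extendedRees c *
        ⟨C a * T (n : ℤ), F.C_mul_T_mem_extendedRees_iff.mpr ha'⟩ :=
      Subtype.ext (by
        rw [hq, MulMemClass.coe_mul, Subalgebra.coe_algebraMap, ← C_eq_algebraMap, smul_eq_mul,
          map_mul, mul_assoc])
    rw [e]
    exact Ideal.mul_mem_left _ _ (iha _ rfl)

end Ring

/-! ## Pull-backs of powers of ideal sheaves along open immersions -/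

/-- Powers of ideal sheaves commute with pull-back along an open immersion (the sections over an
affine `W` are those over its image, through a ring isomorphism). [folklore] -/
theorem comap_pow_of_isOpenImmersion {X X' : Scheme.{u}} (g : X' ⟶ X) [IsOpenImmersion g]
    (K : X.IdealSheafData) (n : ℕ) : (K ^ n).comap g = K.comap g ^ n := by
  refine Scheme.IdealSheafData.ext (funext fun W => ?_)
  rw [Scheme.IdealSheafData.ideal_comap_of_isOpenImmersion, Scheme.IdealSheafData.ideal_pow,
    Pi.pow_apply, Scheme.IdealSheafData.ideal_pow, Pi.pow_apply,
    Scheme.IdealSheafData.ideal_comap_of_isOpenImmersion, CentreHomogeneous.ideal_comap_iso_inv,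
    CentreHomogeneous.ideal_comap_iso_inv, Ideal.map_pow]

/-! ## The charts `D(uᵢ t^{wᵢ})` of a scheme over `Y` and `𝔸¹` glued from the `Spec ⊕ₙ 𝒥ₙ(U) tⁿ`

As in `…Theorems.DatumToEmbedded.StrictTransform`, everything is stated for an ARBITRARY scheme
`B` with morphisms `π : B ⟶ Y`, `τ : B ⟶ 𝔸¹ = Spec ℤ[x]`, an open `O ⊆ B` and a chart
`φ : Spec ⊕ₙ 𝒥ₙ(U) tⁿ ⟶ B` over an affine open `U ⊆ Y` (an open immersion with
`φ ≫ π = Spec(Γ(Y, U) → ⊕ 𝒥ₙ(U) tⁿ) ≫ (U ↪ Y)`, `φ ≫ τ = Spec(x ↦ t⁻¹)` and `φ(vertex complement)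
⊆ O`, as `R'.openCover.f U` is by `R'.ι_π`, `R'.ι_toA1`, `R'.image_plusChart_le_plus`), on which
the filtration is the weighted filtration of `(u, w)`; `v i = uᵢ t^{wᵢ} ∈ ⊕ₙ 𝒥ₙ(U) tⁿ`. -/

section Chart

variable {Y B : Scheme.{u}} (π : B ⟶ Y)
  (τ : B ⟶ Spec (CommRingCat.of (Polynomial ReesFiltration.ZZ.{u}))) (O : B.Opens)
  (R' : ReesFiltration Y) (U : Y.affineOpens)
  (φ : Spec (CommRingCat.of (R'.sectionsRing U)) ⟶ B)
  (hφπ : φ ≫ π =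
    Spec.map (CommRingCat.ofHom (algebraMap Γ(Y, U) (R'.sectionsRing U))) ≫ U.2.fromSpec)
  (hφA : φ ≫ τ = Spec.map (CommRingCat.ofHom (R'.polyToSections U)))
  (hO : ∀ x, x ∈ R'.plusChart U → φ x ∈ O)
  {m : ℕ} (u : Fin m → Γ(Y, U)) (w : Fin m → ℕ) (hw : ∀ i, 0 < w i)
  (h : ∀ n, (R'.ideal n).ideal U = Ideal.span (weightedMonomials u w n))
  (v : Fin m → R'.sectionsRing U)
  (hv : ∀ i, ((v i : R'.sectionsRing U) : (Γ(Y, U))[T;T⁻¹]) = C (u i) * T (w i : ℤ))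
  (L : Fin m → Type u) [∀ i, CommRing (L i)] [∀ i, Algebra (R'.sectionsRing U) (L i)]
  [∀ i, IsLocalization.Away (v i) (L i)]

include hw h hv in
/-- The chart `Spec (⊕ 𝒥ₙ(U) tⁿ)[1/(uᵢ t^{wᵢ})] → Spec ⊕ 𝒥ₙ(U) tⁿ` lands in the complement of the
vertex `V(⊕_{n>0} 𝒥ₙ(U) tⁿ)` (`uᵢ t^{wᵢ}` is in the irrelevant ideal). [folklore] -/
theorem specMap_mem_plusChart (i : Fin m) (x : Spec (CommRingCat.of (L i))) :
    Spec.map (CommRingCat.ofHom (algebraMap (R'.sectionsRing U) (L i))) x ∈ R'.plusChart U := by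
  rw [R'.mem_plusChart_iff]
  intro hle
  have hmem : algebraMap (R'.sectionsRing U) (L i) (v i) ∈ x.asIdeal :=
    hle (v_mem_irrelevant (R'.filtration U) u w h v hv (hw i))
  exact x.2.ne_top (Ideal.eq_top_of_isUnit_mem _ hmem
    (IsLocalization.Away.algebraMap_isUnit (v i)))

include hO hw h hv in
/-- **The chart `ψᵢ : Spec (⊕ 𝒥ₙ(U) tⁿ)[1/(uᵢ t^{wᵢ})] ⟶ O` exists**: the localisation chart
followed by `φ` lands in `O ⊇ φ(vertex complement)`. [folklore] -/
theorem exists_fac (i : Fin m) :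
    ∃ ψ : Spec (CommRingCat.of (L i)) ⟶ (O : Scheme.{u}), ψ ≫ O.ι =
      Spec.map (CommRingCat.ofHom (algebraMap (R'.sectionsRing U) (L i))) ≫ φ := by
  refine ⟨IsOpenImmersion.lift O.ι _ ?_, IsOpenImmersion.lift_fac _ _ _⟩
  rintro _ ⟨x, rfl⟩
  rw [Scheme.Opens.range_ι]
  exact hO _ (specMap_mem_plusChart R' U u w hw h v hv L i x)

include h hv in
/-- **The charts `D(uᵢ t^{wᵢ})` cover the complement of the vertex**: every point of
`Spec ⊕ 𝒥ₙ(U) tⁿ` off `V(⊕_{n>0} 𝒥ₙ(U) tⁿ)` lies in some `D(uᵢ t^{wᵢ})`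
(`irrelevant_le_span_range`). [cite: Wlodarczyk2022, Def. 2.3.5] -/
theorem exists_specMap_eq (q : Spec (CommRingCat.of (R'.sectionsRing U)))
    (hq : q ∈ R'.plusChart U) :
    ∃ (i : Fin m) (x : Spec (CommRingCat.of (L i))),
      Spec.map (CommRingCat.ofHom (algebraMap (R'.sectionsRing U) (L i))) x = q := by
  obtain ⟨i, hi⟩ : ∃ i, v i ∉ q.asIdeal := by
    by_contra hcon
    simp only [not_exists, not_not] at hcon
    refine (R'.mem_plusChart_iff U q).mp hq ((irrelevant_le_span_range (R'.filtration U) u w h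
      ⟨T (-1), (R'.filtration U).T_neg_one_mem_extendedRees⟩ rfl v hv).trans ?_)
    rw [Ideal.span_le]
    rintro _ ⟨i, rfl⟩
    exact hcon i
  have hq' : q ∈ Set.range (PrimeSpectrum.comap (algebraMap (R'.sectionsRing U) (L i))) := by
    rw [PrimeSpectrum.localization_away_comap_range (L i) (v i)]
    exact hi
  obtain ⟨x, hx⟩ := hq'
  exact ⟨i, x, hx⟩

variable [IsOpenImmersion φ] {i : Fin m} (ψ : Spec (CommRingCat.of (L i)) ⟶ (O : Scheme.{u}))
  (hψ : ψ ≫ O.ι = Spec.map (CommRingCat.ofHom (algebraMap (R'.sectionsRing U) (L i))) ≫ φ)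

include v hψ in
/-- `ψᵢ` is an open immersion. [folklore] -/
theorem isOpenImmersion_of_fac : IsOpenImmersion ψ := by
  haveI : IsOpenImmersion (Spec.map (CommRingCat.ofHom
      (algebraMap (R'.sectionsRing U) (L i)))) :=
    IsOpenImmersion.of_isLocalization (v i)
  haveI : IsOpenImmersion (ψ ≫ O.ι) := by rw [hψ]; infer_instance
  exact IsOpenImmersion.of_comp ψ O.ι

omit [IsOpenImmersion φ] in
include hφπ hv hψ in
/-- **The piece `𝒥ₙ` on the chart `ψᵢ`**: for `wᵢ ∣ n` and an ideal sheaf `K` with `K(U) = 𝒥ₙ(U)`,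
the pull-back of `(O ⟶ B ⟶ Y)^* K` along `ψᵢ` is the ideal sheaf of `((t⁻¹)ⁿ)`
(`map_span_weightedMonomials`). [cite: Wlodarczyk2022, Lemma 2.3.8] -/
theorem comap_comap_eq_ofIdealTop (K : Y.IdealSheafData) {n : ℕ}
    (hK : K.ideal U = Ideal.span (weightedMonomials u w n)) (hn : w i ∣ n) :
    (K.comap (O.ι ≫ π)).comap ψ = Scheme.IdealSheafData.ofIdealTop ((Ideal.span
      {algebraMap (R'.sectionsRing U) (L i)
        ⟨T (-1), (R'.filtration U).T_neg_one_mem_extendedRees⟩ ^ n}).map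
      (Scheme.ΓSpecIso (CommRingCat.of (L i))).inv.hom) := by
  rw [← Scheme.IdealSheafData.comap_comp, ← Category.assoc, hψ, Category.assoc, hφπ,
    ← Spec.map_comp_assoc, ← CommRingCat.ofHom_comp]
  refine Scheme.IdealSheafData.ext_of_isAffine ?_
  rw [CentreHomogeneous.comap_SpecMap_fromSpec_ideal_top, ideal_ofIdealTop_top,
    CommRingCat.hom_ofHom, hK, map_span_weightedMonomials (R'.filtration U) u w
      ⟨T (-1), (R'.filtration U).T_neg_one_mem_extendedRees⟩ rfl v hv _ hn
      (IsLocalization.Away.algebraMap_isUnit (v i))]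

include hφA v hψ in
/-- **The exceptional ideal on the chart `ψᵢ`**: the pull-back of `((τ^*(x))|_O)ⁿ` along `ψᵢ` is
the ideal sheaf of `((t⁻¹)ⁿ)`. [cite: Wlodarczyk2022, Lemma 2.3.8] -/
theorem comap_pow_eq_ofIdealTop (n : ℕ) :
    ((((affineBlowup.idealSheaf
        (Ideal.span {(Polynomial.X : Polynomial ReesFiltration.ZZ.{u})})).comap τ).comap O.ι) ^
        n).comap ψ = Scheme.IdealSheafData.ofIdealTop ((Ideal.span
      {algebraMap (R'.sectionsRing U) (L i)
        ⟨T (-1), (R'.filtration U).T_neg_one_mem_extendedRees⟩ ^ n}).map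
      (Scheme.ΓSpecIso (CommRingCat.of (L i))).inv.hom) := by
  haveI := isOpenImmersion_of_fac O R' U φ v L ψ hψ
  rw [comap_pow_of_isOpenImmersion, ← Scheme.IdealSheafData.comap_comp,
    ← Scheme.IdealSheafData.comap_comp, hψ, Category.assoc, hφA, ← Spec.map_comp,
    ← CommRingCat.ofHom_comp, affineBlowup.idealSheaf, comap_ofIdealTop_SpecMap, ← ofIdealTop_pow,
    ← Ideal.map_pow, Ideal.map_span, Set.image_singleton, Ideal.span_singleton_pow,
    RingHom.comp_apply, ReesFiltration.polyToSections_X]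

include hφπ hφA hv hψ in
/-- **`𝒥ₙ · 𝒪 = (t⁻¹)ⁿ` on the chart `ψᵢ`** for `wᵢ ∣ n`. [cite: Wlodarczyk2022, Lemma 2.3.8] -/
theorem comap_comap_eq_comap_pow (K : Y.IdealSheafData) {n : ℕ}
    (hK : K.ideal U = Ideal.span (weightedMonomials u w n)) (hn : w i ∣ n) :
    (K.comap (O.ι ≫ π)).comap ψ = ((((affineBlowup.idealSheaf
        (Ideal.span {(Polynomial.X : Polynomial ReesFiltration.ZZ.{u})})).comap τ).comap O.ι) ^
        n).comap ψ :=
  (comap_comap_eq_ofIdealTop π O R' U φ hφπ u w v hv L ψ hψ K hK hn).trans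
    (comap_pow_eq_ofIdealTop τ O R' U φ hφA v L ψ hψ n).symm

end Chart

end Summit.ResolutionOfSingularities.ResolutionOfSingularities.Theorems.DatumToEmbedded.Exceptional

end
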